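import Mathlib
import Literature.Analysis.FluidPDE.CKNPressureHessianSlice
import Summits.NavierStokesRegularity.NavierStokesRegularity.Theorems.EulerZoomLiouvillePowerGaugeEulerLiouvillePastFrameSteadyConfined
import HarnessLib

/-!
# ROTATING-FRAME-STEADY PAST MEMBERS ARE TRIVIAL — the rotational twin of F1c `FrameSteady.ae_eq_zero_of_gauge_of_pastFrameSteady_confined`
# (crux `EulerZoomLiouville.PowerGaugeEulerLiouville` = stmt-NavierStokesRegularity-19832; line `galilean_frames` symmetry strata; width seat ns-ezl-w3 g5)

Route №10 `EulerZoomLiouville` (NavierStokesRegularity), crux E.  A member `(u, p, H)` of Seregin's power-gauged class (suitable weak Euler pair on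
`(−∞,0) × ℝ³`, weak spatial gradient `H`, gauge `a^{2ρ}A(a) + a^{ρ}E(a) + a^{2ρ}D(a) ≤ c` for all `a > 0`) that is STEADY IN A ROTATING FRAME below
some time `T₁ ≤ 0` — `u(τ, y) = R(τ) U(R(τ)⁻¹ y) + η(τ)` for `τ < T₁`, with an ARBITRARY profile `U`, an ARBITRARY path `R : ℝ → O(3)` of linear
isometries (no regularity in `τ`: tumbling, spinning, reflections) and a background `η` — VANISHES a.e. on the slab
(`RotatingFrame.ae_eq_zero_of_gauge_of_pastRotatingFrameSteady`).  Unlike the Galilean case (F1e: an escaping frame sees only the far field), the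
`E`-gauge is blind to rotations about the origin: `|H(τ)|_F(y)` dominates `‖G₀(R(τ)⁻¹y)‖` where `G₀` is the ONE profile gradient carrying every slice.

ROUTE (tree tools only): (1) weak derivatives transport under linear isometries (`RotatingFrame.hasWeakFDerivOn_comp_isometry`; with
`HasWeakFDerivOn.clm_comp` and uniqueness, `RotatingFrame.exists_profileGradient_rot`: `H(τ) = R(τ) G₀(R(τ)⁻¹·) R(τ)⁻¹` a.e. for a.e. `τ < T₁`);
(2) packing in continuous time (`RotatingFrame.window_mul_le_of_gaugeE_rot`: `L ∫_{B_a}‖G₀‖² ≤ c a^{1−ρ}` from `a^ρ E(a) ≤ c`, Tonelli on the window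
`(T₁−L, T₁) × B_a`, rotation invariance of balls `RotatingFrame.setLIntegral_ball_comp_isometry`, `‖M‖ ≤ ‖RMR⁻¹‖ ≤ |RMR⁻¹|_F`); (3) `G₀ = 0`
(`RotatingFrame.setLIntegral_profileGradient_rot_eq_zero`, windows `L → ∞`, `a = L + 1 + |T₁|`, exponent `1 − ρ < 1`); (4) `H = 0` a.e. below `T₁`, so
a.e. slice is a.e. constant with zero energy under the `A`-gauge and the member vanishes (`PowerGaugeSteady.ae_slice_const_of_weakGradient_ae_zero`,
`PastPeriodic.lintegral_slice_eq_zero_of_ae_const_of_gaugeA`, `PastSymmetric.ae_eq_zero_of_gauge_of_pastSlicesZero`, verbatim as in F1c).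

WHAT THIS IS NOT: not NS regularity, not the crux E — one more symmetry stratum of the crux CLASS 19832 (MODEL lattice; E/NS strata),
`--supports` stmt-19832; 19832 OPEN. [folklore]
-/

noncomputable section

-- flat `Theorems/<Route><Decl>…` files of one crux share the namespace of the crux (tree convention: `Summit.<S>.<S>.…`)
set_option linter.dupNamespace false

open MeasureTheory Set Filter Topology Metric Function TopologicalSpace
open scoped ENNReal NNReal

namespace Summit.NavierStokesRegularity.NavierStokesRegularity.Theorems.PowerGaugeEulerLiouville

open Literature.Analysis Literature.Analysis.FunctionSpaces Literature.Analysis.FluidPDE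

namespace RotatingFrame

variable {u : ℝ → EuclideanSpace ℝ (Fin 3) → EuclideanSpace ℝ (Fin 3)}
  {H : ℝ → EuclideanSpace ℝ (Fin 3) → EuclideanSpace ℝ (Fin 3) →L[ℝ] EuclideanSpace ℝ (Fin 3)}
  {T₁ : ℝ} {U : EuclideanSpace ℝ (Fin 3) → EuclideanSpace ℝ (Fin 3)}
  {R : ℝ → EuclideanSpace ℝ (Fin 3) ≃ₗᵢ[ℝ] EuclideanSpace ℝ (Fin 3)} {η : ℝ → EuclideanSpace ℝ (Fin 3)}

/-! ## (0) Linear isometries: balls, operator norms, weak derivatives -/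

/-- Rotated ball integrals: `∫⁻_{B(0,r)} F(L z) dz = ∫⁻_{B(0,r)} F` for a linear isometry `L`. [folklore] -/
theorem setLIntegral_ball_comp_isometry (L : EuclideanSpace ℝ (Fin 3) ≃ₗᵢ[ℝ] EuclideanSpace ℝ (Fin 3))
    (F : EuclideanSpace ℝ (Fin 3) → ℝ≥0∞) (r : ℝ) :
    ∫⁻ z in ball (0 : EuclideanSpace ℝ (Fin 3)) r, F (L z) = ∫⁻ y in ball (0 : EuclideanSpace ℝ (Fin 3)) r, F y := by
  have h := L.measurePreserving.setLIntegral_comp_preimage_emb L.toMeasurableEquiv.measurableEmbedding F (ball 0 r)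
  have hpre : ⇑L ⁻¹' ball (0 : EuclideanSpace ℝ (Fin 3)) r = ball 0 r := by
    ext z
    simp only [mem_preimage, mem_ball, dist_zero_right, LinearIsometryEquiv.norm_map]
  rw [hpre] at h
  exact h

/-- Conjugation by a linear isometry does not decrease the operator norm: `‖M‖ ≤ ‖L M L⁻¹‖`. [folklore] -/
theorem opNorm_le_opNorm_conj (L : EuclideanSpace ℝ (Fin 3) ≃ₗᵢ[ℝ] EuclideanSpace ℝ (Fin 3))
    (M : EuclideanSpace ℝ (Fin 3) →L[ℝ] EuclideanSpace ℝ (Fin 3)) :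
    ‖M‖ ≤ ‖(L : EuclideanSpace ℝ (Fin 3) →L[ℝ] EuclideanSpace ℝ (Fin 3)).comp
      (M.comp (L.symm : EuclideanSpace ℝ (Fin 3) →L[ℝ] EuclideanSpace ℝ (Fin 3)))‖ := by
  refine ContinuousLinearMap.opNorm_le_bound _ (norm_nonneg _) fun v => ?_
  have h := ((L : EuclideanSpace ℝ (Fin 3) →L[ℝ] EuclideanSpace ℝ (Fin 3)).comp
    (M.comp (L.symm : EuclideanSpace ℝ (Fin 3) →L[ℝ] EuclideanSpace ℝ (Fin 3)))).le_opNorm (L v)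
  simp only [ContinuousLinearMap.comp_apply, LinearIsometryEquiv.coe_coe'', LinearIsometryEquiv.symm_apply_apply,
    LinearIsometryEquiv.norm_map] at h
  simpa using h

/-- **Weak derivatives transport under linear isometries**: if `g` is a weak derivative of `f` on `ℝ³`, then `y ↦ g(Ly) ∘ L` is a weak derivative
of `f ∘ L` (test `ψ = φ ∘ L⁻¹` and change variables; Evans, *PDE*, §5.2). [folklore] -/
theorem hasWeakFDerivOn_comp_isometry {F : Type*} [NormedAddCommGroup F] [NormedSpace ℝ F]
    (L : EuclideanSpace ℝ (Fin 3) ≃ₗᵢ[ℝ] EuclideanSpace ℝ (Fin 3)) {f : EuclideanSpace ℝ (Fin 3) → F}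
    {g : EuclideanSpace ℝ (Fin 3) → EuclideanSpace ℝ (Fin 3) →L[ℝ] F}
    (h : HasWeakFDerivOn (⊤ : Opens (EuclideanSpace ℝ (Fin 3))) volume f g) :
    HasWeakFDerivOn (⊤ : Opens (EuclideanSpace ℝ (Fin 3))) volume (fun y => f (L y))
      (fun y => (g (L y)).comp (L : EuclideanSpace ℝ (Fin 3) →L[ℝ] EuclideanSpace ℝ (Fin 3))) := by
  have hmp : MeasurePreserving (⇑L) volume volume := L.measurePreserving
  have hme : MeasurableEmbedding (⇑L) := L.toMeasurableEquiv.measurableEmbedding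
  have hmap : Measure.map (⇑L.toHomeomorph) (volume : Measure (EuclideanSpace ℝ (Fin 3))) = volume := hmp.map_eq
  -- local integrability transports along the homeomorphism `L`
  have hli : ∀ {G : Type _} [NormedAddCommGroup G] {k : EuclideanSpace ℝ (Fin 3) → G},
      LocallyIntegrable k volume → LocallyIntegrable (fun y => k (L y)) volume := by
    intro G _ k hk
    have e : (fun y => k (L y)) = k ∘ L.toHomeomorph := rfl
    rw [e, ← locallyIntegrable_map_homeomorph L.toHomeomorph, hmap]
    exact hk
  have hf : LocallyIntegrable f volume := by
    have := h.locallyIntegrableOn; rwa [Opens.coe_top, locallyIntegrableOn_univ] at this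
  have hg : LocallyIntegrable g volume := by
    have := h.locallyIntegrableOn_deriv; rwa [Opens.coe_top, locallyIntegrableOn_univ] at this
  refine ⟨?_, ?_, fun φ v hφ => ?_⟩
  · rw [Opens.coe_top, locallyIntegrableOn_univ]; exact hli hf
  · rw [Opens.coe_top]
    have h1 : LocallyIntegrable (fun y => g (L y)) volume := hli hg
    have h2 := ((ContinuousLinearMap.compL ℝ (EuclideanSpace ℝ (Fin 3)) (EuclideanSpace ℝ (Fin 3)) F).flip
      (L : EuclideanSpace ℝ (Fin 3) →L[ℝ] EuclideanSpace ℝ (Fin 3))).locallyIntegrableOn_comp (locallyIntegrableOn_univ.2 h1)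
    have e : (fun y => (g (L y)).comp (L : EuclideanSpace ℝ (Fin 3) →L[ℝ] EuclideanSpace ℝ (Fin 3))) =
        (⇑((ContinuousLinearMap.compL ℝ (EuclideanSpace ℝ (Fin 3)) (EuclideanSpace ℝ (Fin 3)) F).flip
          (L : EuclideanSpace ℝ (Fin 3) →L[ℝ] EuclideanSpace ℝ (Fin 3))) ∘ fun y => g (L y)) := by
      funext y; simp
    rw [e]
    exact h2
  · have hφd : Differentiable ℝ φ := hφ.contDiff.differentiable (by simp)
    set ψ : EuclideanSpace ℝ (Fin 3) → ℝ := fun x => φ (L.symm x) with hψ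
    have hψt : IsTestFunctionOn (⊤ : Opens (EuclideanSpace ℝ (Fin 3))) ψ :=
      { contDiff := hφ.contDiff.comp L.symm.toContinuousLinearEquiv.contDiff
        hasCompactSupport := hφ.hasCompactSupport.comp_homeomorph L.symm.toHomeomorph
        tsupport_subset := by simp }
    have hψd : Differentiable ℝ ψ := hψt.contDiff.differentiable (by simp)
    have hφψ : ∀ y, φ y = ψ (L y) := fun y => by simp only [hψ, LinearIsometryEquiv.symm_apply_apply]
    -- `∂_v φ (y) = ∂_{Lv} ψ (L y)`
    have hD : ∀ y, fderiv ℝ φ y v = fderiv ℝ ψ (L y) (L v) := by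
      intro y
      have hc : HasFDerivAt (fun y => ψ (L y))
          ((fderiv ℝ ψ (L y)).comp (L : EuclideanSpace ℝ (Fin 3) →L[ℝ] EuclideanSpace ℝ (Fin 3))) y :=
        (hψd (L y)).hasFDerivAt.comp y (L : EuclideanSpace ℝ (Fin 3) →L[ℝ] EuclideanSpace ℝ (Fin 3)).hasFDerivAt
      have e : (fun y => ψ (L y)) = φ := funext fun y => (hφψ y).symm
      rw [e] at hc
      rw [hc.fderiv, ContinuousLinearMap.comp_apply]
      rfl
    have key := h.integral_fderiv_smul_eq ψ (L v) hψt
    simp only [Opens.coe_top, Measure.restrict_univ] at key ⊢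
    -- change variables `x = L y` on both sides
    have h1 : ∫ y, (fderiv ℝ φ y v) • f (L y) = ∫ x, (fderiv ℝ ψ x (L v)) • f x := by
      rw [← hmp.integral_comp hme (fun x => (fderiv ℝ ψ x (L v)) • f x)]
      refine integral_congr_ae (ae_of_all _ fun y => ?_)
      simp only [hD]
    have h2 : ∫ y, φ y • ((g (L y)).comp (L : EuclideanSpace ℝ (Fin 3) →L[ℝ] EuclideanSpace ℝ (Fin 3))) v =
        ∫ x, ψ x • g x (L v) := by
      rw [← hmp.integral_comp hme (fun x => ψ x • g x (L v))]
      refine integral_congr_ae (ae_of_all _ fun y => ?_)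
      simp only [ContinuousLinearMap.comp_apply, hφψ]
      rfl
    rw [h1, h2, key]

/-! ## (1) One profile gradient carries every slice -/

/-- **ONE FIELD CARRIES EVERY SLICE (rotating frame).**  If `u(τ, ·) = R(τ) U(R(τ)⁻¹ ·) + η(τ)` for `τ < T₁ ≤ 0` and `H` is a weak spatial gradient of
`u` on the slab, there is an a.e.-strongly measurable field `G₀` with `H(τ, y) = R(τ) ∘ G₀(R(τ)⁻¹ y) ∘ R(τ)⁻¹` a.e., for a.e. `τ < T₁` (two good slices
are conjugate: `hasWeakFDerivOn_comp_isometry`, `HasWeakFDerivOn.clm_comp`, constants have weak derivative `0`, uniqueness). [folklore] -/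
theorem exists_profileGradient_rot
    (hH : HasWeakSpatialGradientOn (slab (EuclideanSpace ℝ (Fin 3)) (Iio 0) isOpen_Iio) u H) (hT₁ : T₁ ≤ 0)
    (hu : ∀ τ : ℝ, τ < T₁ → u τ = fun y => R τ (U ((R τ).symm y)) + η τ) :
    ∃ G₀ : EuclideanSpace ℝ (Fin 3) → EuclideanSpace ℝ (Fin 3) →L[ℝ] EuclideanSpace ℝ (Fin 3),
      AEStronglyMeasurable G₀ volume ∧
      ∀ᵐ τ ∂(volume.restrict (Iio T₁)), H τ =ᵐ[volume] fun y =>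
        (R τ : EuclideanSpace ℝ (Fin 3) →L[ℝ] EuclideanSpace ℝ (Fin 3)).comp
          ((G₀ ((R τ).symm y)).comp ((R τ).symm : EuclideanSpace ℝ (Fin 3) →L[ℝ] EuclideanSpace ℝ (Fin 3))) := by
  have hgood := FrameSteady.ae_hasWeakFDerivOn_slice_past hH hT₁
  -- a good slice `τ₀`
  have hne : (ae (volume.restrict (Iio T₁))).NeBot := by
    rw [ae_neBot, Ne, Measure.restrict_eq_zero, Real.volume_Iio]; exact ENNReal.top_ne_zero
  obtain ⟨τ₀, hτ₀, hτ₀T⟩ := (hgood.and (ae_restrict_mem measurableSet_Iio)).exists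
  set G₀ : EuclideanSpace ℝ (Fin 3) → EuclideanSpace ℝ (Fin 3) →L[ℝ] EuclideanSpace ℝ (Fin 3) := fun w =>
    ((R τ₀).symm : EuclideanSpace ℝ (Fin 3) →L[ℝ] EuclideanSpace ℝ (Fin 3)).comp
      ((H τ₀ (R τ₀ w)).comp (R τ₀ : EuclideanSpace ℝ (Fin 3) →L[ℝ] EuclideanSpace ℝ (Fin 3))) with hG₀
  refine ⟨G₀, ?_, ?_⟩
  · -- measurability: `G₀` is a continuous conjugate of the measurable slice `H τ₀ ∘ R τ₀`
    have h1 : AEStronglyMeasurable (H τ₀) volume := by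
      have := hτ₀.locallyIntegrableOn_deriv.aestronglyMeasurable
      rwa [Opens.coe_top, Measure.restrict_univ] at this
    have h2 : AEStronglyMeasurable (fun w => H τ₀ (R τ₀ w)) volume :=
      h1.comp_quasiMeasurePreserving (R τ₀).measurePreserving.quasiMeasurePreserving
    have hc : Continuous fun M : EuclideanSpace ℝ (Fin 3) →L[ℝ] EuclideanSpace ℝ (Fin 3) =>
        ((R τ₀).symm : EuclideanSpace ℝ (Fin 3) →L[ℝ] EuclideanSpace ℝ (Fin 3)).comp
          (M.comp (R τ₀ : EuclideanSpace ℝ (Fin 3) →L[ℝ] EuclideanSpace ℝ (Fin 3))) :=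
      continuous_const.clm_comp (continuous_id.clm_comp continuous_const)
    exact hc.comp_aestronglyMeasurable h2
  · filter_upwards [hgood, ae_restrict_mem measurableSet_Iio] with τ hτ hτT
    -- the relative rotation `L = R τ₀ ∘ (R τ)⁻¹`: `u τ = L⁻¹ ∘ u τ₀ ∘ L + const`
    set L : EuclideanSpace ℝ (Fin 3) ≃ₗᵢ[ℝ] EuclideanSpace ℝ (Fin 3) := (R τ).symm.trans (R τ₀) with hL
    have hLa : ∀ y, L y = R τ₀ ((R τ).symm y) := fun y => rfl
    have hLs : ∀ x, L.symm x = R τ ((R τ₀).symm x) := fun x => rfl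
    set κ : EuclideanSpace ℝ (Fin 3) := η τ - R τ ((R τ₀).symm (η τ₀)) with hκ
    have hrel : u τ = fun y => (L.symm : EuclideanSpace ℝ (Fin 3) →L[ℝ] EuclideanSpace ℝ (Fin 3)) (u τ₀ (L y)) + κ := by
      rw [hu τ hτT]
      funext y
      rw [hu τ₀ hτ₀T]
      simp only [LinearIsometryEquiv.coe_coe'', hLa, hLs, map_add, LinearIsometryEquiv.symm_apply_apply, hκ]
      abel
    have h1 : HasWeakFDerivOn (⊤ : Opens (EuclideanSpace ℝ (Fin 3))) volume (fun y => u τ₀ (L y))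
        (fun y => (H τ₀ (L y)).comp (L : EuclideanSpace ℝ (Fin 3) →L[ℝ] EuclideanSpace ℝ (Fin 3))) :=
      hasWeakFDerivOn_comp_isometry L hτ₀
    have h2 := h1.clm_comp (L.symm : EuclideanSpace ℝ (Fin 3) →L[ℝ] EuclideanSpace ℝ (Fin 3))
    have hc : HasWeakFDerivOn (⊤ : Opens (EuclideanSpace ℝ (Fin 3))) volume (fun _ : EuclideanSpace ℝ (Fin 3) => -κ)
        (fderiv ℝ fun _ : EuclideanSpace ℝ (Fin 3) => -κ) :=
      HasWeakFDerivOn.of_contDiff_holds ⊤ volume contDiff_const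
    have h3 := h2.sub hc
    have e1 : ((fun y => (L.symm : EuclideanSpace ℝ (Fin 3) →L[ℝ] EuclideanSpace ℝ (Fin 3)) (u τ₀ (L y))) -
        fun _ : EuclideanSpace ℝ (Fin 3) => -κ) = u τ := by
      rw [hrel]; funext y; simp only [Pi.sub_apply, sub_neg_eq_add]
    have e2 : ((fun y => (L.symm : EuclideanSpace ℝ (Fin 3) →L[ℝ] EuclideanSpace ℝ (Fin 3)).comp
          ((H τ₀ (L y)).comp (L : EuclideanSpace ℝ (Fin 3) →L[ℝ] EuclideanSpace ℝ (Fin 3)))) -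
        fderiv ℝ fun _ : EuclideanSpace ℝ (Fin 3) => -κ) =
        fun y => (L.symm : EuclideanSpace ℝ (Fin 3) →L[ℝ] EuclideanSpace ℝ (Fin 3)).comp
          ((H τ₀ (L y)).comp (L : EuclideanSpace ℝ (Fin 3) →L[ℝ] EuclideanSpace ℝ (Fin 3))) := by
      funext y; simp
    rw [e1, e2] at h3
    have h4 := HasWeakFDerivOn.unique_holds hτ h3
    rw [Opens.coe_top, Measure.restrict_univ] at h4
    filter_upwards [h4] with y hy
    rw [hy]
    apply ContinuousLinearMap.ext
    intro v
    simp only [hG₀, ContinuousLinearMap.comp_apply, LinearIsometryEquiv.coe_coe'', hLa, hLs]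

/-! ## (2) E-gauge packing in continuous time, rotating frame -/

/-- **THE PACKING BOUND (rotating frame).**  If `H(τ) = R(τ) G₀(R(τ)⁻¹·) R(τ)⁻¹` a.e. for a.e. `τ < T₁ ≤ 0`, `L + |T₁| ≤ a`, `1 ≤ a`, and
`a^ρ E(H; Q_a(0)) ≤ c`, then `L · ∫_{B_a} ‖G₀‖² ≤ c a^{1−ρ}` (Tonelli on the window `(T₁ − L, T₁) × B_a`; on each good slice
`‖G₀(R⁻¹y)‖ ≤ ‖H(τ,y)‖ ≤ |H(τ,y)|_F` and the ball is rotation invariant). [folklore] -/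
theorem window_mul_le_of_gaugeE_rot
    (hH : HasWeakSpatialGradientOn (slab (EuclideanSpace ℝ (Fin 3)) (Iio 0) isOpen_Iio) u H) (hT₁ : T₁ ≤ 0)
    {G₀ : EuclideanSpace ℝ (Fin 3) → EuclideanSpace ℝ (Fin 3) →L[ℝ] EuclideanSpace ℝ (Fin 3)}
    (hrep : ∀ᵐ τ ∂(volume.restrict (Iio T₁)), H τ =ᵐ[volume] fun y =>
        (R τ : EuclideanSpace ℝ (Fin 3) →L[ℝ] EuclideanSpace ℝ (Fin 3)).comp
          ((G₀ ((R τ).symm y)).comp ((R τ).symm : EuclideanSpace ℝ (Fin 3) →L[ℝ] EuclideanSpace ℝ (Fin 3))))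
    {L a : ℝ} (ha1 : 1 ≤ a) (hLa : L + |T₁| ≤ a)
    {ρ : ℝ} {c : ℝ≥0} (hE : ENNReal.ofReal (a ^ ρ) * cknE a (0 : ℝ × EuclideanSpace ℝ (Fin 3)) H ≤ (c : ℝ≥0∞)) :
    ENNReal.ofReal L * ∫⁻ y in ball (0 : EuclideanSpace ℝ (Fin 3)) a, ENNReal.ofReal (‖G₀ y‖ ^ 2) ≤
      ENNReal.ofReal ((c : ℝ) * a ^ (1 - ρ)) := by
  have ha0 : 0 < a := by linarith
  set f : ℝ × EuclideanSpace ℝ (Fin 3) → ℝ≥0∞ := fun z => ENNReal.ofReal (frobeniusNormSq (H z.1 z.2)) with hf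
  set I : ℝ≥0∞ := ∫⁻ y in ball (0 : EuclideanSpace ℝ (Fin 3)) a, ENNReal.ofReal (‖G₀ y‖ ^ 2) with hI
  -- the window box sits in `Q_a(0)`
  have hwin : Ioo (T₁ - L) T₁ ×ˢ ball (0 : EuclideanSpace ℝ (Fin 3)) a ⊆ Ioo (-(a ^ 2)) 0 ×ˢ ball (0 : EuclideanSpace ℝ (Fin 3)) a := by
    refine Set.prod_mono (fun τ hτ => ⟨?_, lt_of_lt_of_le hτ.2 hT₁⟩) Subset.rfl
    have h1 : a ≤ a ^ 2 := by nlinarith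
    linarith [hτ.1, neg_abs_le T₁]
  have hgauge := TimePeriodic.setLIntegral_window_le_of_gaugeE (H := H) (T := a ^ 2) ha0 le_rfl le_rfl hE
  refine le_trans ?_ ((lintegral_mono_set hwin).trans hgauge)
  -- Tonelli on the window box
  have hmeas : AEMeasurable f ((volume.restrict (Ioo (T₁ - L) T₁)).prod (volume.restrict (ball (0 : EuclideanSpace ℝ (Fin 3)) a))) := by
    have h1 : AEStronglyMeasurable (uncurry H) (volume.restrict (Ioo (T₁ - L) T₁ ×ˢ ball (0 : EuclideanSpace ℝ (Fin 3)) a)) := by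
      have h0 := hH.locallyIntegrableOn_grad.aestronglyMeasurable
      rw [coe_slab] at h0
      exact h0.mono_set (Set.prod_mono (fun τ hτ => lt_of_lt_of_le hτ.2 hT₁) (subset_univ _))
    rw [Measure.volume_eq_prod, ← Measure.prod_restrict] at h1
    exact ((ENNReal.continuous_ofReal.comp LerayHopfProofs.continuous_frobeniusNormSq).comp_aestronglyMeasurable h1).aemeasurable
  rw [Measure.volume_eq_prod, ← Measure.prod_restrict, lintegral_prod _ hmeas]
  -- slice by slice: `I ≤ ∫_{B_a} f(τ, ·)` for a.e. `τ` in the window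
  have hslice : ∀ᵐ τ ∂(volume.restrict (Ioo (T₁ - L) T₁)), I ≤ ∫⁻ y in ball (0 : EuclideanSpace ℝ (Fin 3)) a, f (τ, y) := by
    filter_upwards [ae_restrict_of_ae_restrict_of_subset (fun τ hτ => hτ.2 : Ioo (T₁ - L) T₁ ⊆ Iio T₁) hrep] with τ hτ
    -- rotate the ball: `I = ∫_{B_a} ‖G₀((R τ)⁻¹ y)‖² dy`
    have e : I = ∫⁻ y in ball (0 : EuclideanSpace ℝ (Fin 3)) a, ENNReal.ofReal (‖G₀ ((R τ).symm y)‖ ^ 2) := by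
      rw [hI, setLIntegral_ball_comp_isometry (R τ).symm (fun y => ENNReal.ofReal (‖G₀ y‖ ^ 2)) a]
    rw [e]
    refine lintegral_mono_ae (ae_restrict_of_ae ?_)
    filter_upwards [hτ] with y hy
    simp only [hf, hy]
    refine ENNReal.ofReal_le_ofReal ?_
    have h1 := opNorm_le_opNorm_conj (R τ) (G₀ ((R τ).symm y))
    have h2 := sq_opNorm_le_frobeniusNormSq
      ((R τ : EuclideanSpace ℝ (Fin 3) →L[ℝ] EuclideanSpace ℝ (Fin 3)).comp
        ((G₀ ((R τ).symm y)).comp ((R τ).symm : EuclideanSpace ℝ (Fin 3) →L[ℝ] EuclideanSpace ℝ (Fin 3))))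
    exact le_trans (by gcongr) h2
  calc ENNReal.ofReal L * I = ∫⁻ _ in Ioo (T₁ - L) T₁, I := by
        rw [lintegral_const, Measure.restrict_apply_univ, Real.volume_Ioo, show T₁ - (T₁ - L) = L by ring, mul_comm]
    _ ≤ ∫⁻ τ in Ioo (T₁ - L) T₁, ∫⁻ y in ball (0 : EuclideanSpace ℝ (Fin 3)) a, f (τ, y) := lintegral_mono_ae hslice

/-- **THE PROFILE GRADIENT VANISHES** (`0 < ρ < 1`): for every `Rb`, `∫_{B_Rb} ‖G₀‖² = 0` — windows `L → ∞` with `a = L + 1 + |T₁|` give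
`∫_{B_a}‖G₀‖² ≤ c (L + 1 + |T₁|)^{1−ρ}/L → 0`. [folklore] -/
theorem setLIntegral_profileGradient_rot_eq_zero
    (hH : HasWeakSpatialGradientOn (slab (EuclideanSpace ℝ (Fin 3)) (Iio 0) isOpen_Iio) u H) (hT₁ : T₁ ≤ 0)
    {G₀ : EuclideanSpace ℝ (Fin 3) → EuclideanSpace ℝ (Fin 3) →L[ℝ] EuclideanSpace ℝ (Fin 3)}
    (hrep : ∀ᵐ τ ∂(volume.restrict (Iio T₁)), H τ =ᵐ[volume] fun y =>
        (R τ : EuclideanSpace ℝ (Fin 3) →L[ℝ] EuclideanSpace ℝ (Fin 3)).comp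
          ((G₀ ((R τ).symm y)).comp ((R τ).symm : EuclideanSpace ℝ (Fin 3) →L[ℝ] EuclideanSpace ℝ (Fin 3))))
    {ρ : ℝ} (hρ : 0 < ρ) (hρ1 : ρ < 1) {c : ℝ≥0}
    (hE : ∀ a : ℝ, 0 < a → ENNReal.ofReal (a ^ ρ) * cknE a (0 : ℝ × EuclideanSpace ℝ (Fin 3)) H ≤ (c : ℝ≥0∞)) (Rb : ℝ) :
    ∫⁻ y in ball (0 : EuclideanSpace ℝ (Fin 3)) Rb, ENNReal.ofReal (‖G₀ y‖ ^ 2) = 0 := by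
  set g : EuclideanSpace ℝ (Fin 3) → ℝ≥0∞ := fun y => ENNReal.ofReal (‖G₀ y‖ ^ 2) with hg
  set C₀ : ℝ := 1 + |T₁| with hC₀
  have hC₀1 : 1 ≤ C₀ := by rw [hC₀]; linarith [abs_nonneg T₁]
  have key : ∀ L : ℝ, 1 ≤ L → Rb ≤ L →
      ∫⁻ y in ball (0 : EuclideanSpace ℝ (Fin 3)) Rb, g y ≤ ENNReal.ofReal ((c : ℝ) * ((L + C₀) ^ (1 - ρ) / L)) := by
    intro L hL1 hLR
    have hL : 0 < L := by linarith
    set a : ℝ := L + C₀ with ha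
    have ha1 : 1 ≤ a := by rw [ha]; linarith
    have ha0 : 0 < a := by linarith
    have hLa : L + |T₁| ≤ a := by rw [ha, hC₀]; linarith
    have hpack := window_mul_le_of_gaugeE_rot hH hT₁ hrep ha1 hLa (hE a ha0)
    have hRa : Rb ≤ a := by rw [ha]; linarith
    have h1 : ENNReal.ofReal L * ∫⁻ y in ball (0 : EuclideanSpace ℝ (Fin 3)) Rb, g y ≤ ENNReal.ofReal ((c : ℝ) * a ^ (1 - ρ)) :=
      le_trans (mul_le_mul' le_rfl (lintegral_mono_set (ball_subset_ball hRa))) hpack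
    have hL0' : ENNReal.ofReal L ≠ 0 := (ENNReal.ofReal_pos.2 hL).ne'
    have h2 : ∫⁻ y in ball (0 : EuclideanSpace ℝ (Fin 3)) Rb, g y ≤ ENNReal.ofReal ((c : ℝ) * a ^ (1 - ρ)) / ENNReal.ofReal L := by
      rw [ENNReal.le_div_iff_mul_le (Or.inl hL0') (Or.inl ENNReal.ofReal_ne_top), mul_comm]; exact h1
    refine h2.trans ?_
    rw [← ENNReal.ofReal_div_of_pos hL, ha]
    exact le_of_eq (by ring_nf)
  -- the right-hand side tends to `0` along `L = n → ∞`
  have hlim : Tendsto (fun n : ℕ => ENNReal.ofReal ((c : ℝ) * ((((n : ℝ)) + C₀) ^ (1 - ρ) / (n : ℝ)))) atTop (𝓝 0) := by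
    set γ : ℝ := 1 - ρ with hγ
    have hγ1 : γ < 1 := by rw [hγ]; linarith
    have hγpos : 0 < γ := by rw [hγ]; linarith
    -- `(n + C₀)^γ / n ≤ 2^γ n^{γ−1}` for `n ≥ C₀`, and `n^{γ−1} → 0`
    have h0 : Tendsto (fun n : ℕ => (2 : ℝ) ^ γ * (n : ℝ) ^ (γ - 1)) atTop (𝓝 0) := by
      have h1 : Tendsto (fun n : ℕ => ((n : ℝ)) ^ (γ - 1)) atTop (𝓝 0) := by
        have := (tendsto_rpow_neg_atTop (by linarith : 0 < 1 - γ)).comp tendsto_natCast_atTop_atTop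
        refine this.congr fun n => ?_
        simp only [Function.comp, neg_sub]
      have h2 := h1.const_mul ((2 : ℝ) ^ γ)
      rwa [mul_zero] at h2
    have hbd : ∀ᶠ n : ℕ in atTop, ((n : ℝ) + C₀) ^ γ / (n : ℝ) ≤ (2 : ℝ) ^ γ * (n : ℝ) ^ (γ - 1) := by
      filter_upwards [eventually_ge_atTop (Nat.ceil C₀)] with n hn
      have hnC : C₀ ≤ n := (Nat.le_ceil C₀).trans (by exact_mod_cast hn)
      have hn0 : (0 : ℝ) < n := by linarith
      have hγ0 : 0 ≤ γ := by rw [hγ]; linarith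
      have h1 : ((n : ℝ) + C₀) ^ γ ≤ (2 * (n : ℝ)) ^ γ := Real.rpow_le_rpow (by linarith) (by linarith) hγ0
      rw [div_le_iff₀ hn0]
      calc ((n : ℝ) + C₀) ^ γ ≤ (2 * (n : ℝ)) ^ γ := h1
        _ = (2 : ℝ) ^ γ * (n : ℝ) ^ (γ - 1) * n := by
          rw [Real.mul_rpow (by norm_num) hn0.le, Real.rpow_sub_one hn0.ne', mul_assoc, div_mul_cancel₀ _ hn0.ne']
    have hnn : ∀ᶠ n : ℕ in atTop, 0 ≤ ((n : ℝ) + C₀) ^ γ / (n : ℝ) :=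
      Eventually.of_forall fun n => div_nonneg (Real.rpow_nonneg (add_nonneg n.cast_nonneg (by linarith)) _) n.cast_nonneg
    have h3 : Tendsto (fun n : ℕ => ((n : ℝ) + C₀) ^ γ / (n : ℝ)) atTop (𝓝 0) :=
      tendsto_of_tendsto_of_tendsto_of_le_of_le' tendsto_const_nhds h0 hnn hbd
    have h4 := h3.const_mul (c : ℝ)
    rw [mul_zero] at h4
    have h5 := ENNReal.tendsto_ofReal h4
    rwa [ENNReal.ofReal_zero] at h5
  have key' : ∀ᶠ n : ℕ in atTop, ∫⁻ y in ball (0 : EuclideanSpace ℝ (Fin 3)) Rb, g y ≤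
      ENNReal.ofReal ((c : ℝ) * ((((n : ℝ)) + C₀) ^ (1 - ρ) / (n : ℝ))) := by
    filter_upwards [eventually_ge_atTop (max 1 (Nat.ceil Rb))] with n hn
    have hn1 : (1 : ℝ) ≤ n := by exact_mod_cast (le_max_left _ _).trans hn
    have hnR : Rb ≤ n := (Nat.le_ceil Rb).trans (by exact_mod_cast (le_max_right _ _).trans hn)
    exact key n hn1 hnR
  exact le_antisymm (le_of_tendsto_of_tendsto tendsto_const_nhds hlim key') bot_le

/-! ## (3) The stratum -/

/-- **ROTATING-FRAME-STEADY PAST MEMBERS ARE TRIVIAL** (`0 < ρ < 1`).  Let `(u, p)` be a suitable weak Euler pair on `(−∞,0) × ℝ³` with weak spatial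
gradient `H` in Seregin's class `a^{2ρ}A(a) + a^{ρ}E(a) + a^{2ρ}D(a) ≤ c` (all `a > 0`); suppose `u(τ, ·) = R(τ) U(R(τ)⁻¹ ·) + η(τ)` for all `τ < T₁ ≤ 0`
with an arbitrary profile `U`, an arbitrary path `R` of linear isometries of `ℝ³` (no regularity in `τ`) and a background `η`.  Then `u = 0` a.e. on
the slab. [folklore] -/
theorem ae_eq_zero_of_gauge_of_pastRotatingFrameSteady {ρ : ℝ} (hρ : 0 < ρ) (hρ1 : ρ < 1)
    {p : ℝ → EuclideanSpace ℝ (Fin 3) → ℝ} {c : ℝ≥0}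
    (hsw : IsSuitableWeakSolutionOn (slab (EuclideanSpace ℝ (Fin 3)) (Iio 0) isOpen_Iio) 0 0 u p)
    (hH : HasWeakSpatialGradientOn (slab (EuclideanSpace ℝ (Fin 3)) (Iio 0) isOpen_Iio) u H)
    (hc : ∀ a : ℝ, 0 < a → ENNReal.ofReal (a ^ (2 * ρ)) * cknA a (0 : ℝ × EuclideanSpace ℝ (Fin 3)) u +
        ENNReal.ofReal (a ^ ρ) * cknE a (0 : ℝ × EuclideanSpace ℝ (Fin 3)) H +
        ENNReal.ofReal (a ^ (2 * ρ)) * cknD a (0 : ℝ × EuclideanSpace ℝ (Fin 3)) p ≤ (c : ℝ≥0∞))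
    (hT₁ : T₁ ≤ 0) (hu : ∀ τ : ℝ, τ < T₁ → u τ = fun y => R τ (U ((R τ).symm y)) + η τ) :
    uncurry u =ᵐ[volume.restrict (Iio (0 : ℝ) ×ˢ (univ : Set (EuclideanSpace ℝ (Fin 3))))] 0 := by
  have hE : ∀ a : ℝ, 0 < a → ENNReal.ofReal (a ^ ρ) * cknE a (0 : ℝ × EuclideanSpace ℝ (Fin 3)) H ≤ (c : ℝ≥0∞) :=
    fun a ha => le_trans (le_trans le_add_self le_self_add) (hc a ha)
  have hA : ∀ a : ℝ, 0 < a → ENNReal.ofReal (a ^ (2 * ρ)) * cknA a (0 : ℝ × EuclideanSpace ℝ (Fin 3)) u ≤ (c : ℝ≥0∞) :=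
    fun a ha => le_trans (le_trans le_self_add le_self_add) (hc a ha)
  -- (1) one field carries every slice; (2) it vanishes
  obtain ⟨G₀, hG₀m, hrep⟩ := exists_profileGradient_rot hH hT₁ hu
  have hG0 : G₀ =ᵐ[volume] 0 := by
    have hball : ∀ n : ℕ, ∀ᵐ y ∂(volume.restrict (ball (0 : EuclideanSpace ℝ (Fin 3)) (n : ℝ))), G₀ y = 0 := by
      intro n
      have hm : AEMeasurable (fun y => ENNReal.ofReal (‖G₀ y‖ ^ 2)) (volume.restrict (ball (0 : EuclideanSpace ℝ (Fin 3)) (n : ℝ))) :=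
        (ENNReal.measurable_ofReal.comp_aemeasurable ((hG₀m.norm.aemeasurable.pow_const 2))).restrict
      have h0 := (lintegral_eq_zero_iff' hm).1 (setLIntegral_profileGradient_rot_eq_zero hH hT₁ hrep hρ hρ1 hE n)
      filter_upwards [h0] with y hy
      have h1 : ‖G₀ y‖ ^ 2 ≤ 0 := ENNReal.ofReal_eq_zero.1 hy
      exact norm_eq_zero.1 (by nlinarith [norm_nonneg (G₀ y)])
    have hU : (univ : Set (EuclideanSpace ℝ (Fin 3))) = ⋃ n : ℕ, ball (0 : EuclideanSpace ℝ (Fin 3)) (n : ℝ) := by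
      ext y; simp only [mem_univ, mem_iUnion, mem_ball_zero_iff, true_iff]; exact exists_nat_gt ‖y‖
    have := (ae_restrict_iUnion_iff (μ := (volume : Measure (EuclideanSpace ℝ (Fin 3)))) (s := fun n : ℕ => ball 0 (n : ℝ))
      (p := fun y => G₀ y = 0)).2 hball
    rwa [← hU, Measure.restrict_univ] at this
  -- (3) `H = 0` a.e. below `T₁`
  have hslice0 : ∀ᵐ τ ∂(volume.restrict (Iio T₁)), H τ =ᵐ[volume] 0 := by
    filter_upwards [hrep] with τ hτ
    have h1 := (R τ).symm.measurePreserving.quasiMeasurePreserving.ae_eq hG0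
    refine hτ.trans ?_
    filter_upwards [h1] with y hy
    simp only [Function.comp_apply, Pi.zero_apply] at hy
    simp only [hy, ContinuousLinearMap.zero_comp, ContinuousLinearMap.comp_zero, Pi.zero_apply]
  have hHm : AEStronglyMeasurable (uncurry H) (volume.restrict (Iio T₁ ×ˢ (univ : Set (EuclideanSpace ℝ (Fin 3))))) := by
    have h0 := hH.locallyIntegrableOn_grad.aestronglyMeasurable
    rw [coe_slab] at h0
    exact h0.mono_set (Set.prod_mono (Iio_subset_Iio hT₁) Subset.rfl)
  have hH0 := FrameSteady.ae_zero_of_ae_slice hHm hslice0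
  -- (4) a.e. slice below `T₁` is a.e. constant with zero energy
  have hslice := TypeIliouvilleNoTypeII.PowerGaugeSteady.ae_slice_const_of_weakGradient_ae_zero isOpen_Iio
    (hH.mono (slab_mono (Iio_subset_Iio hT₁))) hH0
  have hzero : ∀ᵐ τ ∂(volume.restrict (Iio T₁)), ∫⁻ x, ‖u τ x‖ₑ ^ 2 = 0 := by
    filter_upwards [hslice, ae_restrict_mem measurableSet_Iio] with τ hτ hτT
    obtain ⟨b, hb⟩ := hτ
    exact PastPeriodic.lintegral_slice_eq_zero_of_ae_const_of_gaugeA hρ hA (lt_of_lt_of_le hτT hT₁) hb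
  exact PastSymmetric.ae_eq_zero_of_gauge_of_pastSlicesZero hρ.le hsw hH hc hzero

end RotatingFrame

end Summit.NavierStokesRegularity.NavierStokesRegularity.Theorems.PowerGaugeEulerLiouville

end
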